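import Summits.HodgeConjecture.HodgeConjecture.Cruxes.BlochSeedDiscOne.SeedChecker
import Literature.AlgebraicGeometry.HodgeTheory.GAGALineBundlesProofs
import Literature.AlgebraicGeometry.Modules.LineBundleOfCocycleClass
import Literature.AlgebraicGeometry.Modules.DetClassTensor
import Literature.AlgebraicGeometry.AbelianVarieties.LineBundleTensorPower
import HarnessLib

/-!
# Seed checker v17 (hsemireg-c5c8-1 g16, 2026-08-30) — ADDITIVE satellite of `SeedChecker.lean` v4: THE HIGH-TWIST REGIME
# «at `t ≫ 0`, C5, C6 and the object half of (σ) are FREE; C7 is the ONLY object-side check»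

Crux workfile for `stmt-HodgeConjecture-18881` (`BlochSeedDiscOne := HasHyperbolicBlochSeed 4 1`, route
`EightfoldBlochSeeds`; stub of record `Lines/birth.lean :: stub_rung_pad4_seedAt`, UNTOUCHED). Imports ONLY v4
`SeedChecker.lean` among the crux workfiles (the satellites v5–v16 are `remote:stale:…:unbuilt` on the farm snapshot and cannot
be imported; re-probed this generation) plus four BUILT Literature modules (the glued line bundle `𝒪_X(Θ)` of a Cartier
divisor, its rank, ranks of tensor products ∕ powers).

## What this file types (director-hodge g20 A5: «C5–C8 as predicates on (design json, presentation); flag the vacuous ∕ implied ones»)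

bc5 W36's C5 (regular section of a twist `𝓔(tH)`, `Z = Z(s)` lci of codimension `4`), C6 (`Z(s)` integral, closed points of
codimension `≥ 4`) and the object half of (σ) (`q·h_K⁴ + w_μ` supported on `Z(s)`) are, IN THE HIGH-TWIST REGIME `t ≥ t₀`, consequences
of three CLASSICAL theorems and one law already typed in v4 — none of them about the design:

* **(L-conn) Sommese ∕ Fulton–Lazarsfeld connectedness** (Lazarsfeld, *Positivity II*, Thm. 7.1.1 and Example 7.1.4; Fulton–Lazarsfeld
  1981): the zero locus of EVERY section of an AMPLE bundle of rank `e ≤ n − 1` on an irreducible projective `n`-fold is non-empty and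
  connected; `𝓔(tΘ)` is ample for `t ≫ 0` (loc. cit. §6.1.A). Here `e = 4`, `n = 8`.
* **(L-Bert) Serre + Kleiman–Bertini**: `𝓔(tΘ)` is globally generated for `t ≫ 0` (Serre), and the zero scheme of a GENERAL section of
  a globally generated rank-`e` bundle on a smooth complex variety is smooth of pure codimension `e` (or empty), in particular a regular
  immersion of codimension `e` with every point of codimension `≥ e` (Kleiman 1969 ∕ 1974, char. `0`).
* **(L-int) smooth + connected ⟹ integral** (a connected scheme smooth over `ℂ` is regular, hence normal and locally integral, hence —
  being connected and locally Noetherian — integral; Stacks 056S, 00NP, 033M∕0357).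
* **v4's `TopChernFourLocalisation C`** (Fulton 14.1: `c₄(𝓕)` is supported on `Z(s)`), which with v4's `W`-coordinate theorem
  (`chernFour_eq_of_cleanAtSeed`: `W`-coordinate `−6μ`) discharges the object half of (σ).

Each of (L-conn), (L-Bert), (L-int) is typed below as a NAMED `Prop` (a statement about all abelian varieties ∕ all `ℂ`-schemes, NOT
about the design), NEITHER PROVED NOR ASSERTED, consumed only as a hypothesis `(h : Law)` — the pattern of v4's `TopChernFourLocalisation`.
GIVEN the four laws, the lci door `Design.SeedCheck` (C0 ∧ C5 ∧ C6 ∧ C7 ∧ (σ)) is reached from **`Design.HighTwistCheck`** =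
C0 ∧ «`Θ` ample» ∧ «rank `4`» ∧ «`𝓔(tΘ)` realises the twisted json `D(t)` for every `t`» ∧ **C7∞** («for `t ≫ 0` every regular zero
scheme `Z(s)`, `s ∈ H⁰(𝓔(tΘ))`, is Bloch-semiregular in `(S⁴, 8, 4)`»): `Design.seedCheck_of_highTwist`, and on every CM anchor the
crux BY NAME (`blochSeedDiscOne_of_highTwistChecks`, hypothesis-carrying). FLAGS OF RECORD (cumulative table in the memo): in the
high-twist regime **C5 and C6 are IMPLIED (by laws, not by C0–C4) and carry no design-side content; (σ)-support is implied by the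
v4 law; the ONE object-side predicate left is C7, in the `∀`-section form C7∞** — which is the natural form: at high twist
`H¹(Z(s), N) ≅ H²(S⁴, End 𝓔)` canonically for every regular `s` (Koszul resolution of `𝒪_{Z(s)}` ⊗ `𝓔(tΘ)`, Serre vanishing and
duality kill every other term; pen, memo §4), so semiregularity of `Z(s)` at high twist is a property of `𝓔`, not of `s` or `t`.

JSON SIDE (§8.1, kernel-checked): the twist threshold. For a factor point `x = (α, Re β, Im β)` put `ptBound x = |Re β| + |Im β| − α + 1`;
then `twPt t x` lies in the OPEN positive cone `PosConePt` (`α > 0`, `|β|² < α²` — the ample cone of a factor, by the abelian-surface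
Nakai criterion; that identification is pen, the inequality is Lean) for every `t ≥ ptBound x` (`posConePt_twPt`); a design has the
computable threshold `Design.twBound` (max over its finitely many cells and four factors), beyond which EVERY cell of the twisted json
`D(t)` is in the open cone on every factor (`Design.inPosCone_of_twBound_le`), while C0 and `μ` are carried along (v4 `tw_classData`,
`tw_mu`; packaged as `Design.highTwist_json`). The null letters `ℓ_ζ = (1, ζ̄)` are NOT in the open cone and one twist puts them
there (`decide` examples) — the displayed summands of a twisted presentation `𝓝(t) ↠ 𝓟(t)` are sums of ample line bundles from
`t = twBound` on.

NOT HERE ∕ NOT IN LEAN: ampleness ∕ global generation of modules (the tree has `CartierDivisor.IsAmple` for divisors only — the laws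
are phrased through the twists `𝓔 ⊗ 𝒪(Θ)^{⊗t}` of an ample `Θ`); sheaf cohomology (`H¹(N) ≅ H²(End 𝓔)` stays pen); the conjectural
dictionary «Bloch's `π_{Z(s)}` = a fixed combination of Buchweitz–Flenner's `σ_q(𝓔)`» (NO source found — Buchweitz–Flenner Prop. 8.2
compares `τ_B` with their `τ` for the module `𝒪_Z`, not for `𝓔`; Iacono–Manetti 2013 treat exactly zero loci of sections but prove
annihilation of obstructions, not semiregularity) is NOT typed. Nothing is constructed: no bundle, divisor, section or zero scheme.
**Nothing here is proved toward HC ∕ HC_CM ∕ HC_AV ∕ №4 ∕ 26512 ∕ 18881 ∕ H2; this is a typed file and evidence, not a rung; the stub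
stays open.** No `sorry`, no `axiom`, no `instance`, no `notation`, no attribute games; axioms of the doors = the standard three.
-/

noncomputable section

set_option linter.dupNamespace false

open CategoryTheory AlgebraicGeometry
open Literature.AlgebraicGeometry Literature.AlgebraicGeometry.Motives Literature.AlgebraicGeometry.HodgeTheory
open Literature.AlgebraicTopology.SingularHomology

namespace Summit.HodgeConjecture.HodgeConjecture.Cruxes.BlochSeedDiscOne.SeedChecker

open Summit.HodgeConjecture.HodgeConjecture.Cruxes.BlochSeedDiscOne.Anchor
open Summit.Ventures.HSemireg Summit.Ventures.HSemireg.Pad4Tower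

/-! ## §8 v17 (g16, 2026-08-30) — ADDITIVE: the high-twist regime. No declaration of §1–§7 is changed. -/

section HighTwist

/-! ### §8.1 JSON side: the twist threshold beyond which every cell is in the open positive cone -/

section JsonSideHighTwist

/-- the OPEN positive cone of a factor: `α > 0` and `|β|² < α²` (interior of v4 ∕ Llite's closed future cone `Effective`; on a
factor `E₀ × E₀` with `(α, β) ↦ α·x₀-class + β·(Weil letter)` this is the ample cone by the Nakai–Moishezon criterion for abelian
surfaces — that reading is pen; the predicate is arithmetic and decidable). -/
abbrev PosConePt (x : BPoint) : Prop := 0 < x.1 ∧ x.2.1 ^ 2 + x.2.2 ^ 2 < x.1 ^ 2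

/-- the twist threshold of a factor point: `|Re β| + |Im β| − α + 1`. -/
def ptBound (x : BPoint) : ℤ := |x.2.1| + |x.2.2| - x.1 + 1

/-- **ONE TWIST PAST THE THRESHOLD IS IN THE OPEN CONE**: `t ≥ ptBound x ⟹ twPt t x ∈ PosConePt`
(`α + t ≥ |Re β| + |Im β| + 1 > 0` and `(α + t)² ≥ (|Re β| + |Im β| + 1)² > Re β² + Im β²`). -/
theorem posConePt_twPt {x : BPoint} {t : ℤ} (ht : ptBound x ≤ t) : PosConePt (twPt t x) := by
  obtain ⟨a, b, c⟩ := x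
  simp only [ptBound] at ht
  simp only [PosConePt, twPt]
  have hb := abs_nonneg b
  have hc := abs_nonneg c
  have h1 : |b| + |c| + 1 ≤ a + t := by linarith
  refine ⟨by linarith, ?_⟩
  have h2 : (|b| + |c| + 1) * (|b| + |c| + 1) ≤ (a + t) * (a + t) :=
    mul_le_mul h1 h1 (by linarith) (by linarith)
  nlinarith [sq_abs b, sq_abs c, mul_nonneg hb hc]

/-- the twist direction `(1, 0, 0)` (the class `x₀` of a point on each factor curve, `H = Σ_f pr_f^* x₀`) is in the open cone;
the null letter `ℓ₋ᵢ = (1, 0, −1)` is NOT (it is nef, a fibre class), and ONE twist puts it there. [`decide`] -/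
example : PosConePt (1, 0, 0) ∧ ¬ PosConePt (Letter.pt .l1) ∧ PosConePt (twPt 1 (Letter.pt .l1)) := by decide

/-- the twist threshold of a cell: the max over its four factors. -/
def MCell.twBound (Z : MCell) : ℤ :=
  (Finset.univ : Finset (Fin 4)).sup' Finset.univ_nonempty fun f => ptBound (Z f)

theorem MCell.ptBound_le_twBound (Z : MCell) (f : Fin 4) : ptBound (Z f) ≤ MCell.twBound Z :=
  Finset.le_sup' (fun f => ptBound (Z f)) (Finset.mem_univ f)

/-- a cell is in the open cone on every factor. -/
abbrev MCell.InPosCone (Z : MCell) : Prop := ∀ f : Fin 4, PosConePt (Z f)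

theorem MCell.inPosCone_tw {Z : MCell} {t : ℤ} (ht : ∀ f, ptBound (Z f) ≤ t) : MCell.InPosCone (MCell.tw t Z) :=
  fun f => posConePt_twPt (ht f)

namespace Design

/-- all cells of a design (both sides). -/
def cells (D : Design) : Finset MCell := D.cfg.lower ∪ D.cfg.upper

/-- **THE TWIST THRESHOLD OF A DESIGN** `t₀(D)`: the max over its cells of their thresholds (clipped at `0`; computable from the json). -/
def twBound (D : Design) : ℕ := D.cells.sup fun Z => (MCell.twBound Z).toNat

theorem ptBound_le_twBound (D : Design) {Z : MCell} (hZ : Z ∈ D.cells) (f : Fin 4) : ptBound (Z f) ≤ (D.twBound : ℤ) := by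
  refine (MCell.ptBound_le_twBound Z f).trans ((Int.self_le_toNat _).trans ?_)
  exact_mod_cast Finset.le_sup (f := fun Z : MCell => (MCell.twBound Z).toNat) hZ

theorem tw_cells (t : ℤ) (D : Design) : (D.tw t).cells = D.cells.map (MCell.twEmb t) := by
  simp only [Design.cells, Design.tw, Finset.map_union]

/-- **BEYOND THE THRESHOLD EVERY CELL OF THE TWISTED JSON IS IN THE OPEN CONE** on every factor: `t ≥ t₀(D) ⟹ ∀ Z ∈ cells(D(t)),
Z ∈ PosCone⁴` — the displayed summands of the twisted presentation `𝓝(t)`, `𝓟(t)` are sums of ample line bundles (pen reading). -/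
theorem inPosCone_of_twBound_le (D : Design) {t : ℤ} (ht : (D.twBound : ℤ) ≤ t) :
    ∀ Z ∈ (D.tw t).cells, MCell.InPosCone Z := by
  intro Z hZ
  rw [Design.tw_cells, Finset.mem_map] at hZ
  obtain ⟨Z₀, hZ₀, rfl⟩ := hZ
  exact MCell.inPosCone_tw fun f => (D.ptBound_le_twBound hZ₀ f).trans ht

/-- **THE JSON SIDE OF THE HIGH-TWIST REGIME, PACKAGED**: for `t ≥ t₀(D)` the twisted json `D(t)` still passes C0, has the same
`W`-coordinate `μ` (all that (σ) and the lci door read of the tensor), and all its cells are in the open cone. -/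
theorem highTwist_json (D : Design) (hC0 : D.ClassData) {t : ℤ} (ht : (D.twBound : ℤ) ≤ t) :
    (D.tw t).ClassData ∧ (D.tw t).mu = D.mu ∧ ∀ Z ∈ (D.tw t).cells, MCell.InPosCone Z :=
  ⟨D.tw_classData t hC0, D.tw_mu t, D.inPosCone_of_twBound_le ht⟩

end Design

end JsonSideHighTwist

/-! ### §8.2 OBJECT side: the twists `𝓔(tΘ)`, the three classical laws (named `Prop`s, hypotheses only), C7∞, the doors -/

section ObjectSideHighTwist

universe u

/-- **THE `t`-TH TWIST `𝓔(tΘ) := 𝓔 ⊗ 𝒪_X(Θ)^{⊗t}`** of a module by a Cartier divisor (the tree's glued line bundle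
`Modules.lineBundle Θ.toUnitCocycle` = `𝒪_X(Θ)`, Hartshorne II Ex. 1.22 ∕ III Ex. 4.5; `Modules.tensorObj`, `Modules.tensorPow`).
[cite: Hartshorne1977, II Prop. 6.13 and III Ex. 4.5] -/
def twistBy {X : Scheme.{u}} [AlgebraicGeometry.IsIntegral X] (𝓔 : X.Modules) (Θ : CartierDivisor X) (t : ℕ) : X.Modules :=
  Modules.tensorObj 𝓔 (Modules.tensorPow (Modules.lineBundle Θ.toUnitCocycle) t)

/-- `rank 𝓔(tΘ) = rank 𝓔` (rank of a tensor product with a line bundle: `Modules.hasRank_tensorObj`, `hasRank_tensorPow_one`,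
`UnitCocycle.hasRank_lineBundle`). -/
theorem hasRank_twistBy {X : Scheme.{u}} [AlgebraicGeometry.IsIntegral X] {𝓔 : X.Modules} {r : ℕ} (h𝓔 : HasRank 𝓔 r)
    (Θ : CartierDivisor X) (t : ℕ) : HasRank (twistBy 𝓔 Θ t) r := by
  have h := Modules.hasRank_tensorObj h𝓔
    (Modules.hasRank_tensorPow_one (Modules.UnitCocycle.hasRank_lineBundle Θ.toUnitCocycle) t)
  simpa only [twistBy, mul_one] using h

/-- the PAD-4 anchor `S⁴` is an integral scheme (an abelian variety is geometrically integral over `ℂ`). Stated as a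
`theorem` (typer lint: no instances in crux workfiles): use `haveI := pad4Anchor_isIntegral E₀`. -/
theorem pad4Anchor_isIntegral (E₀ : AbelianVariety ℂ) : AlgebraicGeometry.IsIntegral (pad4Anchor E₀).X.left :=
  GeometricallyIntegral.isIntegral_of_subsingleton (pad4Anchor E₀).X.hom

/-- **LAW (L-conn) — HIGH-TWIST CONNECTEDNESS OF ZERO LOCI (Sommese ∕ Fulton–Lazarsfeld), A NAMED STATEMENT, NEITHER PROVED NOR
ASSERTED HERE** (consumed as `(hconn : HighTwistConnectedness)`): on a complex abelian variety `A` of dimension `n` with an ample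
Cartier divisor `Θ`, for a vector bundle `𝓔` of rank `e` with `e + 1 ≤ n` there is `t₀` such that for every `t ≥ t₀` the zero scheme of
EVERY section of `𝓔(tΘ)` is (non-empty and) connected. Mathematics: `𝓔(tΘ)` is ample for `t ≫ 0` (Lazarsfeld, *Positivity II* §6.1.A);
Sommese's theorem `Hⁱ(X, Z; ℤ) = 0`, `i ≤ n − e`, for the zero locus `Z` of any section of an ample rank-`e` bundle on a smooth projective
`n`-fold (loc. cit. Thm. 7.1.1), whence `Z ≠ ∅` for `e ≤ n` and `Z` connected for `e ≤ n − 1` (loc. cit. Example 7.1.4 = Fulton–Lazarsfeld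
1981, Lemma 1.3). Not in the tree (no ampleness of modules, no relative singular cohomology of a pair), hence a NAMED LAW.
[cite: Lazarsfeld2004II, Thm. 7.1.1 and Example 7.1.4] [cite: FultonLazarsfeld1981, Lemma 1.3] -/
def HighTwistConnectedness : Prop :=
  ∀ (A : AbelianVariety ℂ) [AlgebraicGeometry.IsIntegral A.X.left] (Θ : CartierDivisor A.X.left), Θ.IsAmple →
    ∀ (𝓔 : A.X.left.Modules) (e : ℕ), HasRank 𝓔 e → e + 1 ≤ A.dim →
      ∃ t₀ : ℕ, ∀ t : ℕ, t₀ ≤ t →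
        ∀ (s : Modules.unitModule A.X.left ⟶ twistBy 𝓔 Θ t) ⦃Z : Scheme.{0}⦄ (i : Z ⟶ A.X.left),
          IsZeroSchemeOf s i → ConnectedSpace Z

/-- **LAW (L-Bert) — HIGH-TWIST BERTINI–KLEIMAN (Serre + Kleiman), A NAMED STATEMENT, NEITHER PROVED NOR ASSERTED HERE** (consumed as
`(hbert : HighTwistBertini)`): on a complex abelian variety `A` with an ample Cartier divisor `Θ`, for a vector bundle `𝓔` of rank `e`
there is `t₀` such that for every `t ≥ t₀` SOME section `s` of `𝓔(tΘ)` has a zero scheme `i : Z(s) ↪ A` (Fulton B.3.4) which is a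
regular immersion of codimension `e`, smooth over `ℂ`, with every point of codimension `≥ e` in `A` (`Order.coheight` = dimension of
the local ring of `A`, Stacks 02IZ). Mathematics: `𝓔(tΘ)` is globally generated for `t ≫ 0` (Serre, FAC §66 ∕ Hartshorne II Thm. 5.17);
the zero scheme of a general section of a globally generated rank-`e` bundle on a smooth variety in characteristic `0` is empty or smooth
of pure codimension `e` (Kleiman's Bertini theorem, Kleiman 1969 §3 ∕ 1974), and a section of a rank-`e` bundle on a smooth (Cohen–
Macaulay) variety whose zero scheme has codimension `e` everywhere is regular (Matsumura Thm. 17.4; Fulton A.5, Example 14.1.1). Not in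
the tree, hence a NAMED LAW. (For `e + 1 ≤ dim A` the empty case is excluded by (L-conn).)
[cite: Kleiman1974, Cor. 4 and Rem. 7] [cite: Fulton1998, B.3.4 and Example 14.1.1] [cite: Hartshorne1977, II Thm. 5.17] -/
def HighTwistBertini : Prop :=
  ∀ (A : AbelianVariety ℂ) [AlgebraicGeometry.IsIntegral A.X.left] (Θ : CartierDivisor A.X.left), Θ.IsAmple →
    ∀ (𝓔 : A.X.left.Modules) (e : ℕ), HasRank 𝓔 e →
      ∃ t₀ : ℕ, ∀ t : ℕ, t₀ ≤ t →
        ∃ (s : Modules.unitModule A.X.left ⟶ twistBy 𝓔 Θ t) (Z : Scheme.{0}) (i : Z ⟶ A.X.left),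
          IsZeroSchemeOf s i ∧ IsRegularImmersionOfCodim i e ∧ AlgebraicGeometry.Smooth (i ≫ A.X.hom) ∧
            ∀ z ∈ Set.range i.base, ((e : ℕ) : ℕ∞) ≤ Order.coheight z

/-- **LAW (L-int) — SMOOTH AND CONNECTED ⟹ INTEGRAL, A NAMED STATEMENT, NEITHER PROVED NOR ASSERTED HERE** (consumed as
`(hint : SmoothConnectedIntegral)`): a connected scheme `Z`, closed in a `ℂ`-scheme `X` and smooth over `ℂ`, is integral. Mathematics:
smooth over a field ⟹ all local rings regular (Stacks 056S ∕ 00TV), regular local rings are (normal) domains (Stacks 00NP), and a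
connected locally Noetherian scheme all of whose local rings are domains is integral (Stacks 033M with 0357; Görtz–Wedhorn I Ex. 3.16).
The ingredients are partly in Mathlib (`isIntegral_iff_irreducibleSpace_and_isReduced`) but not assembled, hence a NAMED LAW.
[cite: GortzWedhorn2020, Prop. 3.27 and Exercise 3.16] -/
def SmoothConnectedIntegral : Prop :=
  ∀ (X : Motives.SchemeOver ℂ) ⦃Z : Scheme.{0}⦄ (i : Z ⟶ X.left), IsClosedImmersion i →
    AlgebraicGeometry.Smooth (i ≫ X.hom) → ConnectedSpace Z → AlgebraicGeometry.IsIntegral Z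

variable {E₀ : AbelianVariety ℂ} {ψ₀ : E₀ ⟶ E₀} {C : ChernCharacterBetti}

/-- **C7∞ — BLOCH-SEMIREGULARITY AT HIGH TWIST (the ONE object-side check of the regime; NOT a law, the conjectural input)**: there
is `t₀` such that for every `t ≥ t₀` EVERY regular (codimension-`4`) zero scheme `Z(s)`, `s ∈ H⁰(S⁴, 𝓔(tΘ))`, is Bloch-semiregular in
`(S⁴, n = 8, p = 4)` (the tree's `IsBlochSemiregular i (2·4) 4`). The `∀ s` form is the natural one: for `t ≫ 0`,
`H¹(Z(s), N_{Z(s)}) ≅ H²(S⁴, End 𝓔)` canonically for every regular `s` (Koszul ⊗ `𝓔(tΘ)`; Serre vanishing and duality kill the other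
terms — pen, memo §4), so at high twist semiregularity of `Z(s)` is a property of `𝓔`. A refuter may equally read it with `∃ s`. -/
def EventuallySemiregularZeroLoci [AlgebraicGeometry.IsIntegral (pad4Anchor E₀).X.left]
    (𝓔 : (pad4Anchor E₀).X.left.Modules) (Θ : CartierDivisor (pad4Anchor E₀).X.left) : Prop :=
  ∃ t₀ : ℕ, ∀ t : ℕ, t₀ ≤ t →
    ∀ (s : Modules.unitModule (pad4Anchor E₀).X.left ⟶ twistBy 𝓔 Θ t) ⦃Z : Scheme.{0}⦄ (i : Z ⟶ (pad4Anchor E₀).X.left),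
      IsZeroSchemeOf s i → IsRegularImmersionOfCodim i 4 → IsBlochSemiregular i (2 * 4) 4

/-- **THE HIGH-TWIST CHECKER — a predicate on (design json `D`, presentation = a rank-`4` bundle `𝓔` on the anchor and an ample
Cartier divisor `Θ` with `𝓔(tΘ)` realising the twisted json `D(t)` for every `t`)**: C0 for `D`; `Θ` ample; `rank 𝓔 = 4`; the
DICTIONARY clause «`𝓔(tΘ)` realises `D(t)` through the kit's frame against `h_std`» (v4 `Design.RealisedBy`; it pins
`ch(𝓔(tΘ)) = ch(𝓔)·e^{t h_std}` in the window, i.e. `[Θ]` reads as the json's twist direction `(1,0,0)⁴ = h_std` — certified in practice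
from a termwise-twisted kernel ∕ cokernel ∕ monad presentation, v4 §6.4 + `Design.tw_clean`); and **C7∞**. NO C5, NO C6, NO (σ): in
this regime they are not checks (`Design.seedCheck_of_highTwist`). -/
def Design.HighTwistCheck [AlgebraicGeometry.IsIntegral (pad4Anchor E₀).X.left] (D : Design) (C : ChernCharacterBetti)
    (K : AnchorKit E₀ ψ₀) (𝓔 : (pad4Anchor E₀).X.left.Modules) (Θ : CartierDivisor (pad4Anchor E₀).X.left) : Prop :=
  D.ClassData ∧ Θ.IsAmple ∧ HasRank 𝓔 4 ∧ (∀ t : ℕ, (D.tw t).RealisedBy C K.F (hStd E₀ K.η) (twistBy 𝓔 Θ t)) ∧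
    EventuallySemiregularZeroLoci 𝓔 Θ

/-- `4 + 1 ≤ dim S⁴ = 8` (the numerical hypothesis of (L-conn) at `e = 4`). -/
theorem four_add_one_le_pad4Anchor_dim (hE : E₀.dim = 1) : 4 + 1 ≤ (pad4Anchor E₀).dim := by
  rw [pad4Anchor_dim hE]; norm_num

/-- **THE LCI DOOR IN THE HIGH-TWIST REGIME, GIVEN THE LAWS** — predicate-to-predicate: a pair passing `Design.HighTwistCheck` gives,
for SOME twist `t` and the zero scheme `i : Z(s) ↪ S⁴` of SOME section `s ∈ H⁰(𝓔(tΘ))`, a passing lci-door pair **`D.SeedCheck K i q`**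
(C0 ∧ C5 ∧ C6 ∧ C7 ∧ (σ)). Bookkeeping of the proof = the flag table: `t := t₇ + t₁ + t₂` past the three thresholds; (L-Bert) supplies
`s`, `Z(s)`, C5 (regular immersion, codimension clause) and smoothness; (L-conn) makes `Z(s)` connected, (L-int) integral (C6); C7 is
C7∞ at `(t, s)`; rank `4` of `𝓔(tΘ)` is `hasRank_twistBy`; (A1@Z) with the design's `μ` is the dictionary clause + `Design.tw_mu`;
(σ) is v4's `Design.seedCheck_of_zeroScheme` under `TopChernFourLocalisation`. Nothing is constructed. -/
theorem Design.seedCheck_of_highTwist (hE : E₀.dim = 1) (hψ : ψ₀ ≫ ψ₀ = -(1 • 𝟙 E₀))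
    [AlgebraicGeometry.IsIntegral (pad4Anchor E₀).X.left] {D : Design} (K : AnchorKit E₀ ψ₀)
    {𝓔 : (pad4Anchor E₀).X.left.Modules} {Θ : CartierDivisor (pad4Anchor E₀).X.left}
    (hconn : HighTwistConnectedness) (hbert : HighTwistBertini) (hint : SmoothConnectedIntegral)
    (hloc : TopChernFourLocalisation C) (h : D.HighTwistCheck C K 𝓔 Θ) :
    ∃ (t : ℕ) (s : Modules.unitModule (pad4Anchor E₀).X.left ⟶ twistBy 𝓔 Θ t) (Z : Scheme.{0})
      (i : Z ⟶ (pad4Anchor E₀).X.left) (q : ℚ), IsZeroSchemeOf s i ∧ D.SeedCheck K i q := by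
  obtain ⟨hC0, hΘ, hrk, hR, t₇, h7⟩ := h
  obtain ⟨t₁, h1⟩ := hconn (pad4Anchor E₀) Θ hΘ 𝓔 4 hrk (four_add_one_le_pad4Anchor_dim hE)
  obtain ⟨t₂, h2⟩ := hbert (pad4Anchor E₀) Θ hΘ 𝓔 4 hrk
  obtain ⟨s, Z, i, hZ, hreg, hsm, hcoh⟩ := h2 (t₇ + t₁ + t₂) (by omega)
  have hZconn : ConnectedSpace Z := h1 (t₇ + t₁ + t₂) (by omega) s i hZ
  have hZint : AlgebraicGeometry.IsIntegral Z := hint (pad4Anchor E₀).X i hZ.isClosedImmersion hsm hZconn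
  have hsr : IsBlochSemiregular i (2 * 4) 4 := h7 (t₇ + t₁ + t₂) (by omega) s i hZ hreg
  obtain ⟨q, hq⟩ := D.seedCheck_of_zeroScheme hE hψ hC0 K hloc (hasRank_twistBy hrk Θ _)
    (cleanAtSeed_of_realisedBy_of_mu_eq le_eight_of_mem_koszulWindow (hR _) (D.tw_mu _))
    one_two_three_mem_koszulWindow.1 one_two_three_mem_koszulWindow.2.1 one_two_three_mem_koszulWindow.2.2 s hZ hreg hZint
    hcoh hsr
  exact ⟨t₇ + t₁ + t₂, s, Z, i, q, hZ, hq⟩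

/-- … hence the conclusion of `stub_rung_pad4_seedAt` ON THAT ANCHOR (v4 `seedData_of_seedCheck`), given the laws. -/
theorem seedData_of_highTwist (hE : E₀.dim = 1) (hψ : ψ₀ ≫ ψ₀ = -(1 • 𝟙 E₀))
    [AlgebraicGeometry.IsIntegral (pad4Anchor E₀).X.left] {D : Design} (K : AnchorKit E₀ ψ₀)
    {𝓔 : (pad4Anchor E₀).X.left.Modules} {Θ : CartierDivisor (pad4Anchor E₀).X.left}
    (hconn : HighTwistConnectedness) (hbert : HighTwistBertini) (hint : SmoothConnectedIntegral)
    (hloc : TopChernFourLocalisation C) (h : D.HighTwistCheck C K 𝓔 Θ) :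
    ∃ (e : ProjectiveEmbedding (pad4Anchor E₀).X) (a : complexBetti (projectiveSpace e.n ℂ) 2)
      (w : complexBetti (pad4Anchor E₀).X (2 * 4)),
      IsRationalClass a ∧ a ≠ 0 ∧
      IsHyperbolicWeilType (pad4Anchor E₀) (pad4Action E₀ ψ₀) 4 (symH (pad4Action E₀ ψ₀) e a) ∧
      w ∈ weilClassesOf (pad4Anchor E₀) (pad4Action E₀ ψ₀) 4 1 ∧ IsRationalClass w ∧ w ≠ 0 ∧
      HasBlochSeedAt 4 (pad4Anchor E₀) (symH (pad4Action E₀ ψ₀) e a) w := by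
  obtain ⟨_t, _s, _Z, _i, _q, _hZ, hq⟩ := D.seedCheck_of_highTwist hE hψ K hconn hbert hint hloc h
  exact seedData_of_seedCheck hE hψ hq

/-- **PASSING HIGH-TWIST PAIRS ON EVERY CM ANCHOR ⟹ THE CRUX `BlochSeedDiscOne` BY NAME, GIVEN THE LAWS** (hypothesis-carrying, not
`exact?`-abusable: the four laws AND, per anchor, a design, a kit, a bundle and an ample divisor passing `HighTwistCheck` — data no
one has constructed; integrality of `S⁴` is `pad4Anchor_isIntegral`). Via v4 `blochSeedDiscOne_of_seedChecks`. -/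
theorem blochSeedDiscOne_of_highTwistChecks (hconn : HighTwistConnectedness) (hbert : HighTwistBertini)
    (hint : SmoothConnectedIntegral) (hloc : TopChernFourLocalisation C)
    (h : ∀ (E₀ : AbelianVariety ℂ) (ψ₀ : E₀ ⟶ E₀), E₀.dim = 1 → ψ₀ ≫ ψ₀ = -(1 • 𝟙 E₀) →
      haveI := pad4Anchor_isIntegral E₀
      ∃ (D : Design) (K : AnchorKit E₀ ψ₀) (𝓔 : (pad4Anchor E₀).X.left.Modules)
        (Θ : CartierDivisor (pad4Anchor E₀).X.left), D.HighTwistCheck C K 𝓔 Θ) :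
    Summit.HodgeConjecture.HodgeConjecture.Theses.EightfoldBlochSeeds.BlochSeedDiscOne :=
  blochSeedDiscOne_of_seedChecks fun E₀ ψ₀ hE hψ => by
    haveI := pad4Anchor_isIntegral E₀
    obtain ⟨D, K, 𝓔, Θ, hD⟩ := h E₀ ψ₀ hE hψ
    obtain ⟨_t, _s, Z, i, q, _hZ, hq⟩ := D.seedCheck_of_highTwist hE hψ K hconn hbert hint hloc hD
    exact ⟨D, K, Z, i, q, hq⟩

/-! ### §8.3 Flags of record, typed: what the high-twist regime makes of the C5 ∕ C6 ∕ (σ) conjuncts -/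

/-- **FLAG (C6 at high twist is IMPLIED — by laws, not by C0–C4)**: given (L-conn) and (L-int), for `t` past the connectedness
threshold EVERY smooth zero scheme `Z(s)`, `s ∈ H⁰(𝓔(tΘ))`, is integral. No design datum enters. -/
theorem isIntegral_zeroScheme_of_highTwist [AlgebraicGeometry.IsIntegral (pad4Anchor E₀).X.left]
    {𝓔 : (pad4Anchor E₀).X.left.Modules} {Θ : CartierDivisor (pad4Anchor E₀).X.left} (hconn : HighTwistConnectedness)
    (hint : SmoothConnectedIntegral) (hΘ : Θ.IsAmple) (hrk : HasRank 𝓔 4) (hE : E₀.dim = 1) :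
    ∃ t₀ : ℕ, ∀ t : ℕ, t₀ ≤ t →
      ∀ (s : Modules.unitModule (pad4Anchor E₀).X.left ⟶ twistBy 𝓔 Θ t) ⦃Z : Scheme.{0}⦄ (i : Z ⟶ (pad4Anchor E₀).X.left),
        IsZeroSchemeOf s i → AlgebraicGeometry.Smooth (i ≫ (pad4Anchor E₀).X.hom) → AlgebraicGeometry.IsIntegral Z := by
  obtain ⟨t₀, h1⟩ := hconn (pad4Anchor E₀) Θ hΘ 𝓔 4 hrk (four_add_one_le_pad4Anchor_dim hE)
  exact ⟨t₀, fun t ht s Z i hZ hsm => hint (pad4Anchor E₀).X i hZ.isClosedImmersion hsm (h1 t ht s i hZ)⟩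

/-- **FLAG ((σ) object half at high twist is IMPLIED — by the v4 law)**: for EVERY `t` and EVERY section of `𝓔(tΘ)` whose zero
scheme is `i : Z ↪ S⁴`, `q·h_K⁴ + wOf μ(D)` is supported on `Z` for some rational `q` — v4 `supported_symH_of_zeroScheme` read through
the dictionary clause and `Design.tw_mu`; no threshold, no C5–C7. -/
theorem supported_of_highTwist (hE : E₀.dim = 1) (hψ : ψ₀ ≫ ψ₀ = -(1 • 𝟙 E₀))
    [AlgebraicGeometry.IsIntegral (pad4Anchor E₀).X.left] {D : Design} (K : AnchorKit E₀ ψ₀)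
    {𝓔 : (pad4Anchor E₀).X.left.Modules} {Θ : CartierDivisor (pad4Anchor E₀).X.left} (hloc : TopChernFourLocalisation C)
    (hrk : HasRank 𝓔 4) (hR : ∀ t : ℕ, (D.tw t).RealisedBy C K.F (hStd E₀ K.η) (twistBy 𝓔 Θ t)) (t : ℕ)
    (s : Modules.unitModule (pad4Anchor E₀).X.left ⟶ twistBy 𝓔 Θ t) {Z : Scheme.{0}} {i : Z ⟶ (pad4Anchor E₀).X.left}
    (hZ : IsZeroSchemeOf s i) :
    ∃ q : ℚ, ((q : ℚ) : ℂ) • cupPowTwo (symH (pad4Action E₀ ψ₀) K.pol.e K.pol.a) 4 + K.F.wOf D.mu ∈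
      classesSupportedOn (pad4Anchor E₀).X (Set.range i.base) (2 * 4) :=
  supported_symH_of_zeroScheme hE hψ K hloc (hasRank_twistBy hrk Θ t)
    (cleanAtSeed_of_realisedBy_of_mu_eq le_eight_of_mem_koszulWindow (hR t) (D.tw_mu t))
    one_two_three_mem_koszulWindow.1 one_two_three_mem_koszulWindow.2.1 one_two_three_mem_koszulWindow.2.2 s hZ

/-- **FLAG (C7 is NOT implied)**: the doors above consume C7∞ and nothing in this file or in v4 produces `IsBlochSemiregular`; the
high-twist checker minus C7∞ does not reach `SeedCheck` by any theorem here. (A remark, recorded as the trivial projection: C7∞ is a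
conjunct of `HighTwistCheck`.) -/
theorem Design.HighTwistCheck.semiregular [AlgebraicGeometry.IsIntegral (pad4Anchor E₀).X.left] {D : Design}
    {K : AnchorKit E₀ ψ₀} {𝓔 : (pad4Anchor E₀).X.left.Modules} {Θ : CartierDivisor (pad4Anchor E₀).X.left}
    (h : D.HighTwistCheck C K 𝓔 Θ) : EventuallySemiregularZeroLoci 𝓔 Θ :=
  h.2.2.2.2

end ObjectSideHighTwist

end HighTwist

/-! ## Audit (v17): nothing is decided here

`HighTwistConnectedness`, `HighTwistBertini`, `SmoothConnectedIntegral` are `Prop`s (classical theorems NOT in the tree), consumed only as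
hypotheses, never asserted; `EventuallySemiregularZeroLoci` (C7∞) and `Design.HighTwistCheck` are predicates; `twistBy` is a construction on
honest modules; `PosConePt`, `ptBound`, `MCell.twBound`, `MCell.InPosCone`, `Design.cells`, `Design.twBound` are json arithmetic. Every
`theorem` is proved: json algebra (`posConePt_twPt`, `Design.inPosCone_of_twBound_le`, `Design.highTwist_json`), rank bookkeeping
(`hasRank_twistBy`), integrality of the anchor from the tree (`pad4Anchor_isIntegral`), and repackaging through v4's doors
(`Design.seedCheck_of_highTwist`, `seedData_of_highTwist`, `blochSeedDiscOne_of_highTwistChecks`, the three flag theorems) — all of which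
CARRY the laws and a passing `HighTwistCheck` (data no one has constructed) among their hypotheses. No bundle, divisor, section or zero
scheme is exhibited; HC ∕ HC_CM ∕ HC_AV ∕ №4 ∕ 26512 ∕ `BlochSeedDiscOne` (18881) ∕ H2 are NOT proved here; the stub `stub_rung_pad4_seedAt`
stays open. No `sorry`, no new axiom, no `instance`, no `notation`. -/

end Summit.HodgeConjecture.HodgeConjecture.Cruxes.BlochSeedDiscOne.SeedChecker

end
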